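import Summits.Ventures.QEC.Thresholds.ToricCodeThresholdKernelPT
import Literature.Probability.RandomPlanarGeometry.SAWFiniteMemoryKernelSymmK14
import Literature.Probability.RandomPlanarGeometry.SAWFiniteMemoryZ3KernelSymmK10
import HarnessLib

/-!
# Toric-code thresholds from the KERNEL-checked SYMMETRY-REDUCED Pönitz–Tittmann bounds `μ(ℤ²) ≤ 2.7014`
# (memory 14) and `μ(ℤ³) ≤ 4.7599` (memory 10): `p_c > .0355` (perfect measurement), `y_c > .3701` (loss),
# `p_c > .0111` (noisy measurement, `q = p`) — unconditional, tier CERTIFIED (kernel)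

Venture QEC, `Summits/Ventures/QEC/Thresholds/` (continues `ToricCodeThresholdKernelPT.lean`; LADDER item 03.PTMEM, rung 2).
Inputs, all with axioms `propext`/`Classical.choice`/`Quot.sound` (symmetry-reduced trie certificates checked by `decide +kernel`,
one orbit representative per state class — Pönitz–Tittmann §3 "normalizing states" — via the kernel verifiers
`SAWFiniteMemoryKernelSymm.lean` / `SAWFiniteMemoryZ3KernelSymm.lean`):
`SAW.Zd.connectiveConstant_two_le_27014` (`SAWFiniteMemoryKernelSymmK14.lean`: `10 397` representatives of the `83 141` states of
the memory-14 automaton of `ℤ²`) and `SAW.Zd.FiniteMemory3.connectiveConstant_three_le_47599` (`SAWFiniteMemoryZ3KernelSymmK10.lean`: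
`3084` representatives of the `139 183` states of the memory-10 automaton of `ℤ³`) — the values of Pönitz–Tittmann 2000, Table 2
(`d = 2, k = 14`; `d = 3, k = 10`). Through the unconditional parametric theorems `toricThreshold_connectiveConstant_le`
(perfect measurement), `lossThreshold_inv_connectiveConstant` (loss) and `phenomThreshold_connectiveConstant_three_le`
(noisy measurement):

| theorem | statement | tier |
|---|---|---|
| `toricThreshold_kernelSymmK14`, `thresholdValue_27014_bounds`, `toricThreshold_0355`, `accuracyThreshold_gt_0355`, `hasThreshold_toric_0355`, `ToricCode.accuracyThreshold_minWeight_gt_0355`, `toric_decaysExponentially_0355` | perfect measurement, every min-weight decoder family: **`p_c > .0355`** (`.0355 < p₀(2.7014) < .0356`; kernel decimals so far `.0293 → .0322 → .0343 → .0348` (→ `.0352`, k = 12)) | CERTIFIED (kernel), unconditional |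
| `lossThreshold_kernelSymmK14`, `loss_accuracyThreshold_gt_0370` | loss channel: **`y_c > .3701`** (was `.3669`) | CERTIFIED (kernel), unconditional |
| `phenomThreshold_kernelZ3SymmK10`, `thresholdValue_47599_bounds`, `phenom_accuracyThreshold_gt_0111_std`, `ToricCode.phenom_accuracyThreshold_stMinWeight_gt_0111_std`, `phenom_decaysExponentially_0111` | noisy measurement (`q = p`), every poly-bounded schedule and min-weight space-time decoder family: **`p_c > .0111`** (`.0111 < p₀(4.7599) < .0112`; kernel decimals so far `.0101 → .0106 → .0109 → .0110`); the `_std` names are the standard-axiom twins of the statement-identical CHECKED-native theorems of `ToricCodePhenomenologicalNativeUnconditional.lean` (`μ(ℤ³) ≤ 4.76` by `native_decide`) | CERTIFIED (kernel), unconditional |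

With these the KERNEL phenomenological decimal EQUALS the CHECKED-native one (`.0111`); the perfect-measurement kernel decimal
`.0355` is within `.0003` of the CHECKED-native `.0358` (`μ(ℤ²) ≤ 2.688`, k = 18) and `.0006` of the CONDITIONAL `.0361`
(Pönitz–Tittmann's printed `μ ≤ 2.679193`). NOT A THEOREM ANYWHERE: DKLP's printed `.0373` / `.0114` (numerical connective
constants, CLAIM). Theorem-only file.

## References

* [DennisEtAl2002] E. Dennis, A. Kitaev, A. Landahl, J. Preskill, J. Math. Phys. 43 (2002) 4452,
  arXiv:quant-ph/0110143, §5.3 eqs. (saw_2), (saw_3), (threshold_2d)–(p_c_2d), (threshold_iso_num), (fail_2d), (fail_iso).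
* [PonitzTittmann2000] A. Pönitz, P. Tittmann, Electron. J. Combin. 7 (2000) R21, §3 and Table 2 (`d = 2, k = 14`: `2.7014`;
  `d = 3, k = 10`: `4.7599`).
* [DumerKovalevPryadko2015] I. Dumer, A. A. Kovalev, L. P. Pryadko, PRL 115 (2015) 050502, p. 5.
-/

noncomputable section

namespace Summit.Ventures.QEC.Thresholds

open Filter Topology Finset
open Literature.InformationTheory.QuantumCodes
open Literature.InformationTheory.QuantumCodes.ToricCode
open Literature.Probability.RandomPlanarGeometry

/-! ### Perfect syndrome measurement: `p_c > .0355` -/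

/-- **Toric-code threshold `≥ p₀(2.7014)`, UNCONDITIONAL, tier CERTIFIED (kernel)**, for every minimum-weight decoder
family (perfect measurement), from the kernel-checked symmetry-reduced memory-14 bound `μ(ℤ²) ≤ 2.7014`.
[cite: DennisEtAl2002, §5.3 eqs. (saw_2), (threshold_2d)] -/
theorem toricThreshold_kernelSymmK14 {D : (L : ℕ) → ZDecoder (L + 1)}
    (hD : ∀ L, (D L).IsMinWeight (syn (L + 1)) (cycles (L + 1)) hammingNorm) :
    IsThresholdLowerBound (toricFailureFamily D) (thresholdValue 2.7014) :=
  toricThreshold_connectiveConstant_le (by norm_num) SAW.Zd.connectiveConstant_two_le_27014 hD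

/-- Decimal certificate: `.0355 < p₀(2.7014) < .0356`. [cite: DennisEtAl2002, §5.3 eq. (p_c_2d)] -/
theorem thresholdValue_27014_bounds :
    (0.0355 : ℝ) < thresholdValue 2.7014 ∧ thresholdValue 2.7014 < 0.0356 := by
  unfold thresholdValue
  constructor
  · have : Real.sqrt (1 - 1 / (2.7014 : ℝ) ^ 2) < 0.929 := by
      rw [Real.sqrt_lt' (by norm_num)]
      norm_num
    linarith
  · have : (0.9288 : ℝ) < Real.sqrt (1 - 1 / (2.7014 : ℝ) ^ 2) := by
      rw [Real.lt_sqrt (by norm_num)]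
      norm_num
    linarith

/-- Decimal form: every `0 ≤ p < .0355` is below threshold (perfect measurement, every min-weight decoder family) —
UNCONDITIONAL, tier CERTIFIED (kernel). [cite: DennisEtAl2002, §4.3 and §5.3 eq. (threshold_2d)] -/
theorem toricThreshold_0355 {D : (L : ℕ) → ZDecoder (L + 1)}
    (hD : ∀ L, (D L).IsMinWeight (syn (L + 1)) (cycles (L + 1)) hammingNorm) :
    IsThresholdLowerBound (toricFailureFamily D) 0.0355 :=
  (toricThreshold_kernelSymmK14 hD).anti thresholdValue_27014_bounds.1.le

/-- **`p_c > .0355`** for every minimum-weight decoder family of the toric codes (perfect measurement) — UNCONDITIONAL,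
tier CERTIFIED (kernel). [cite: DennisEtAl2002, §5.3 eq. (p_c_2d)] -/
theorem accuracyThreshold_gt_0355 {D : (L : ℕ) → ZDecoder (L + 1)}
    (hD : ∀ L, (D L).IsMinWeight (syn (L + 1)) (cycles (L + 1)) hammingNorm) :
    (0.0355 : ℝ) < accuracyThreshold (toricFailureFamily D) :=
  lt_of_lt_of_le thresholdValue_27014_bounds.1
    (le_accuracyThreshold (toricThreshold_kernelSymmK14 hD) ((thresholdValue_le_half _).trans (by norm_num)))

/-- The canonical minimum-weight decoders: `p_c > .0355` — UNCONDITIONAL, kernel. [cite: DennisEtAl2002, §5.3 eq. (p_c_2d)] -/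
theorem ToricCode.accuracyThreshold_minWeight_gt_0355 :
    (0.0355 : ℝ) < accuracyThreshold (toricFailureFamily fun L => Decoder.minWeight (syn (L + 1)) hammingNorm) :=
  accuracyThreshold_gt_0355 fun L => ToricCode.isMinWeight_minWeight (L + 1)

/-- `HasThreshold` (PARTITION row-09 vocabulary) at the decimal `.0355` for every minimum-weight decoder family —
UNCONDITIONAL, kernel. [cite: DennisEtAl2002, §4.3 and §5.3 eq. (p_c_2d)] -/
theorem hasThreshold_toric_0355 {D : (L : ℕ) → ZDecoder (L + 1)}
    (hD : ∀ L, (D L).IsMinWeight (syn (L + 1)) (cycles (L + 1)) hammingNorm) :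
    HasThreshold (fun L p => (D L).logicalFailureProb (syn (L + 1)) (boundaries (L + 1))
      (iidLaw (bitLaw (min p.toNNReal 1) (min_le_right _ _)))) 0.0355 :=
  hasThreshold_of_isThresholdLowerBound (toricThreshold_0355 hD) (by norm_num)

/-- **Exponential decay at every `0 ≤ p ≤ .0355`**, UNCONDITIONAL, kernel, for every minimum-weight decoder family (walk-count
constant at `ν = 2.702 > μ(ℤ²)`; `.0355 < p₀(2.702)`). [cite: DennisEtAl2002, §5.3 eq. (fail_2d)] -/
theorem toric_decaysExponentially_0355 {D : (L : ℕ) → ZDecoder (L + 1)}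
    (hD : ∀ L, (D L).IsMinWeight (syn (L + 1)) (cycles (L + 1)) hammingNorm) {p : ℝ}
    (hp₀ : 0 ≤ p) (hpp : p ≤ 0.0355) :
    DecaysExponentially (toricFailureFamily D) p := by
  have hlt : SAW.Zd.connectiveConstant 2 < 2.702 :=
    lt_of_le_of_lt SAW.Zd.connectiveConstant_two_le_27014 (by norm_num)
  obtain ⟨C, hC⟩ := exists_sawCountBound_of_connectiveConstant_lt hlt
  have hval : (0.0355 : ℝ) < thresholdValue 2.702 := by
    unfold thresholdValue
    have : Real.sqrt (1 - 1 / (2.702 : ℝ) ^ 2) < 0.929 := by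
      rw [Real.sqrt_lt' (by norm_num)]
      norm_num
    linarith
  exact toric_decaysExponentially_sawCountBound (by norm_num) hC hD hp₀ (lt_of_le_of_lt hpp hval)

/-! ### The loss channel: `y_c > .3701` -/

/-- **Loss threshold of the toric code `≥ 1/2.7014`** — UNCONDITIONAL, tier CERTIFIED (kernel).
[cite: DumerKovalevPryadko2015, p. 5 (toric erasure threshold)] -/
theorem lossThreshold_kernelSymmK14 : IsThresholdLowerBound erasureFamily (1 / 2.7014) := by
  refine lossThreshold_inv_connectiveConstant.anti ?_
  have h0 : 0 < SAW.Zd.connectiveConstant 2 := lt_of_lt_of_le one_pos (SAW.Zd.one_le_connectiveConstant 2)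
  exact one_div_le_one_div_of_le h0 SAW.Zd.connectiveConstant_two_le_27014

/-- **`y_c > .3701`** for the toric code under the loss channel — UNCONDITIONAL, tier CERTIFIED (kernel).
[cite: DumerKovalevPryadko2015, p. 5] -/
theorem loss_accuracyThreshold_gt_0370 : (0.3701 : ℝ) < accuracyThreshold erasureFamily :=
  lt_of_lt_of_le (by norm_num : (0.3701 : ℝ) < 1 / 2.7014)
    (le_accuracyThreshold lossThreshold_kernelSymmK14 (by norm_num))

/-! ### Noisy syndrome measurement (`q = p`): `p_c > .0111` -/

/-- **Phenomenological toric threshold `≥ p₀(4.7599)`, UNCONDITIONAL, tier CERTIFIED (kernel)**, for every polynomially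
bounded schedule of rounds and every minimum-weight space-time decoder family, from the kernel-checked symmetry-reduced
memory-10 bound `μ(ℤ³) ≤ 4.7599`. [cite: DennisEtAl2002, §5.3 eqs. (saw_3), (threshold_iso_num)] -/
theorem phenomThreshold_kernelZ3SymmK10 {T : ℕ → ℕ} (hT : IsPolyBounded T)
    {D : (L : ℕ) → STDecoder (L + 1) (T L)}
    (hD : ∀ L, (D L).IsMinWeight (stSyn (L + 1) (T L)) (stCycles (L + 1) (T L)) hammingNorm) :
    IsThresholdLowerBound (phenomFailureFamily T D) (thresholdValue 4.7599) :=
  phenomThreshold_connectiveConstant_three_le (by norm_num)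
    SAW.Zd.FiniteMemory3.connectiveConstant_three_le_47599 hT hD

/-- Decimal certificate: `.0111 < p₀(4.7599) < .0112`. [cite: DennisEtAl2002, §5.3 eq. (threshold_iso_num)] -/
theorem thresholdValue_47599_bounds :
    (0.0111 : ℝ) < thresholdValue 4.7599 ∧ thresholdValue 4.7599 < 0.0112 := by
  unfold thresholdValue
  constructor
  · have : Real.sqrt (1 - 1 / (4.7599 : ℝ) ^ 2) < 0.9778 := by
      rw [Real.sqrt_lt' (by norm_num)]
      norm_num
    linarith
  · have : (0.9776 : ℝ) < Real.sqrt (1 - 1 / (4.7599 : ℝ) ^ 2) := by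
      rw [Real.lt_sqrt (by norm_num)]
      norm_num
    linarith

/-- **`p_c > .0111`** under phenomenological noise (`q = p`) for every minimum-weight space-time decoder family and every
polynomially bounded schedule — UNCONDITIONAL, tier CERTIFIED (kernel); the standard-axiom twin of the statement-identical
CHECKED-native `phenom_accuracyThreshold_gt_0111_native_holds`. [cite: DennisEtAl2002, §5.3 eq. (threshold_iso_num)] -/
theorem phenom_accuracyThreshold_gt_0111_std {T : ℕ → ℕ} (hT : IsPolyBounded T)
    {D : (L : ℕ) → STDecoder (L + 1) (T L)}
    (hD : ∀ L, (D L).IsMinWeight (stSyn (L + 1) (T L)) (stCycles (L + 1) (T L)) hammingNorm) :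
    (0.0111 : ℝ) < accuracyThreshold (phenomFailureFamily T D) :=
  lt_of_lt_of_le thresholdValue_47599_bounds.1
    (le_accuracyThreshold (phenomThreshold_kernelZ3SymmK10 hT hD) ((thresholdValue_le_half _).trans (by norm_num)))

/-- The canonical instance (`T(L) = L + 1` rounds, canonical minimum-weight space-time decoders): `p_c > .0111` —
UNCONDITIONAL, kernel; standard-axiom twin of `ToricCode.phenom_accuracyThreshold_stMinWeight_gt_native_holds`.
[cite: DennisEtAl2002, §5.3 eq. (threshold_iso_num)] -/
theorem ToricCode.phenom_accuracyThreshold_stMinWeight_gt_0111_std :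
    (0.0111 : ℝ) < accuracyThreshold
      (phenomFailureFamily (fun L => L + 1) fun L => Decoder.minWeight (stSyn (L + 1) (L + 1)) hammingNorm) :=
  phenom_accuracyThreshold_gt_0111_std isPolyBounded_succ fun L => ToricCode.isMinWeight_stMinWeight (L + 1) (L + 1)

/-- **Exponential decay at every `0 ≤ p ≤ .0111`** under phenomenological noise, UNCONDITIONAL, kernel (cubic walk-count
constant at `ν = 4.77 > μ(ℤ³)`; `.0111 < p₀(4.77)`). [cite: DennisEtAl2002, §5.3 eq. (fail_iso)] -/
theorem phenom_decaysExponentially_0111 {T : ℕ → ℕ} (hT : IsPolyBounded T)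
    {D : (L : ℕ) → STDecoder (L + 1) (T L)}
    (hD : ∀ L, (D L).IsMinWeight (stSyn (L + 1) (T L)) (stCycles (L + 1) (T L)) hammingNorm)
    {p : ℝ} (hp₀ : 0 ≤ p) (hpp : p ≤ 0.0111) :
    DecaysExponentially (phenomFailureFamily T D) p := by
  have hlt : SAW.Zd.connectiveConstant 3 < 4.77 :=
    lt_of_le_of_lt SAW.Zd.FiniteMemory3.connectiveConstant_three_le_47599 (by norm_num)
  obtain ⟨C, hC⟩ := exists_sawCountBound3_of_connectiveConstant_lt hlt
  have hval : (0.0111 : ℝ) < thresholdValue 4.77 := by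
    unfold thresholdValue
    have : Real.sqrt (1 - 1 / (4.77 : ℝ) ^ 2) < 0.9778 := by
      rw [Real.sqrt_lt' (by norm_num)]
      norm_num
    linarith
  exact phenom_decaysExponentially_sawCountBound3' (by norm_num) hC hT hD hp₀ (lt_of_le_of_lt hpp hval)

end Summit.Ventures.QEC.Thresholds
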